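import Literature.AnabelianGeometry.EtaleTheta.Discharge.Sec5Thm57FinalKnit
import Literature.AnabelianGeometry.EtaleTheta.Discharge.Sec5SeedBaseIsoOfCharacteristic
import Literature.AnabelianGeometry.EtaleTheta.Discharge.Sec4RootRebaseModel
import Literature.AnabelianGeometry.EtaleTheta.Discharge.Sec4RootTwistPow

/-!
# [EtTh] §5, Theorem 5.7 at the genuine connected tower — the final knit with its MODEL-LEVEL binders DISCHARGED (pp. 329–331 / PDF pp. 103–105)

Mochizuki, *The étale theta function …*, Publ. RIMS **45** (2009) [cite: MochizukiEtTh2009, Thm 5.7 p.330 (PDF p.104); Rmk 4.3.2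
p.318–319 (PDF pp.92–93); Lem 5.8 p.331 (PDF p.105); Def 4.1 (iii)(iv) p.313 (PDF p.87)].  Seat abc-iut-L2-d4 (gen 5; node `EtTh:Thm5.7`,
row R219, FILE 4).  PROOF-ONLY (0 defs): `thetaRootPreservedAll_ofConnectedTemperoidYddFamily_final` (p446712) with SEVEN of its binders
DISCHARGED by producers already in the tree —
* `hN` ⟸ abc-iut-w4-d008's `TemperedFrobenioid.exists_not_isGroupLikeObj_ofModel` (some object is not group-like);
* `hΨFT` ⟸ abc-iut-L2-t3's T44-L05 via abc-iut-w5-d245's `preservesFrobeniusTrivial_ofConnectedTemperoidData_of_thm44` (p446085);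
* `hbs` ⟸ the Prop. 2.4-class clause `hcharN` ("`A_1^bs` characteristic", p.329 l.5) via abc-iut-w5-d245's
  `BiKummerSetting.nonempty_baseIso_map_of_isTopCharacteristic` (Sec5SeedBaseIsoOfCharacteristic);
* `hpull₂`, `hD N`, `hf` ⟸ the rendering law `hF : pullFrac = pullFracModel` (+ `hαover`, + Thm. 4.4 (ii) `hii`) via abc-iut-f-121's
  `pullFrac_comp_of_rendering` / `NthRoot.rebase_hD_of_comp` / `FractionPair.hf_of_normalisedAnchor` (Sec4RootRebaseModel);
* the `N`-th-power and saturation clauses of `hroot` ⟸ abc-iut-f-121's `pow_twistRoot_eq_pullFrac_of_rendering` (p443529) and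
  `isSaturated_twist_of_fixed` (p438735) at the rebased root — leaving `hroot₁N` proper (an `N`-th root `ũ_N ∈ O^×(B_N)` of the level-1
  discrepancy over `β_{1,N}`, Lem. 5.8) with the `H_{A_N}`-fixedness of the pulled-back twisted function (abc-iut-f-123's p443193 reduces it
  further to the fixedness of a pulled-back constant).
RESIDUAL of `…_final_reduced`: (A) `hnd`, `hgc₁`, `hfac₁`, `hinj`; `hF`, `hαover`; (anchor) `hcharN`, `hdivA`, `hP24`; (§4) `h44`, `ψ`, `hpull`,
`hii`, `h3`, `h4b`, `h8`, `h15a`, `h15`, `D N`, `hArises`, `hebs`, `hroot₁N`, `hivP'`; (C) `hc`.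
HONEST FRAMING: kernel-checked implication for data so parametrised; nothing asserts any result of [EtTh] unconditionally; typed ≠
discharged — PROVED modulo the displayed binders; no side taken on anything downstream ([IUTchIII] Cor. 3.12 in particular). -/

noncomputable section

namespace Literature.AnabelianGeometry.EtaleTheta

open CategoryTheory Opposite Literature.AlgebraicGeometry.Frobenioids Literature.AnabelianGeometry.SemiGraphs
  Literature.AnabelianGeometry.SemiGraphs.GaloisObjects

universe u₀ v₀ w v v' u u'

namespace ThetaFrobenioidTower

section Genuine



variable {K : Type u₀} [Field K] {X : SemiGraphs.TemperedArithmeticGroup.{u₀} K} {D₀ : Type u₀} [Category.{v₀} D₀]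
  {V : FrdIMonoidStub.{w}} {T₀ : RealifiedDivisorMonoids (D₀ := D₀) V}
  {VD : FrdICatStub.{u₀ + 1, u₀, w} (ConnectedPart (BTemp X.Pi))}
  {tf : TemperedFrobenioid T₀ (ConnectedPart (BTemp X.Pi)) VD} {hZ : tf.monoidType = MonoidType.Z}
  {hP : ∀ A : (ConnectedPart (BTemp X.Pi))ᵒᵖ, IsPerfect (tf.Φ.carrier A)}
  {NH : Subgroup (Field.absoluteGaloisGroup K) → tf.category → ℕ+ → Prop}
  {E : Set ℕ+} (𝒯 : ThetaEnvTower.{max u₀ w} E) (ιX : 𝒯.PiX ≃ₜ* X.Pi)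
  {pullFrac : ∀ {A A' : (BiKummerSetting.mkOfConnectedTemperoidYddTower X tf hZ hP NH 𝒯 ιX).C} (_ : A' ⟶ A),
    (BiKummerSetting.mkOfConnectedTemperoidYddTower X tf hZ hP NH 𝒯 ιX).biratUnits A →
      (BiKummerSetting.mkOfConnectedTemperoidYddTower X tf hZ hP NH 𝒯 ιX).biratUnits A'}
  {lv : ℕ+}
  {θ : (BiKummerSetting.mkOfConnectedTemperoidYddTower X tf hZ hP NH 𝒯 ιX).biratUnits
    (BiKummerSetting.mkOfConnectedTemperoidYddTower X tf hZ hP NH 𝒯 ιX).Aodot}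
  {Bl : (BiKummerSetting.mkOfConnectedTemperoidYddTower X tf hZ hP NH 𝒯 ιX).C}
  {Pl : (BiKummerSetting.mkOfConnectedTemperoidYddTower X tf hZ hP NH 𝒯 ιX).FractionPair θ Bl}
  {Rl : (BiKummerSetting.mkOfConnectedTemperoidYddTower X tf hZ hP NH 𝒯 ιX).NthRoot θ Pl lv pullFrac}
  (h : ModelFrobenioid.Hypotheses tf.divisorMonoid tf.ratFnFunctor)
  (Q : FrobenioidTheta.ThetaSubquotientStub.{w} (ConnectedPart (BTemp X.Pi))) (odd_l : Odd (lv : ℕ))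
  (R : ∀ N : ℕ+, (BiKummerSetting.mkOfConnectedTemperoidYddTower X tf hZ hP NH 𝒯 ιX).NthRoot Rl.root Rl.pair N pullFrac)
  (K' : Type w) [Field K'] {X₀ : ConnectedPart (BTemp X.Pi)}
  (hX₀ : ∀ Y : ConnectedPart (BTemp X.Pi), Subsingleton (Y ⟶ X₀)) (t : ∀ N : ℕ+, (R N).BN.base ⟶ X₀)
  (c₀ : K'ˣ →* (tf.ratFnFunctor.obj (op X₀))ˣ)
  (hinj : ∀ N : ℕ+, Function.Injective ((Units.map (tf.ratFnFunctor.map (t N).op).hom).comp c₀))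
  (hinvc : ∀ (N : ℕ+) (g : Aut (R N).AN.base),
    pull tf.divisorMonoid g.hom (ModelFrobenioid.div (R N).pair.num) = ModelFrobenioid.div (R N).pair.num)
  (hinvp : ∀ (N : ℕ+) (y : 𝒯.PiX), y ∈ 𝒯.PiYdd →
    pull tf.divisorMonoid ((BiKummerSetting.mkOfConnectedTemperoidYddTower X tf hZ hP NH 𝒯 ιX).galoisSurj (R N).AN.base
      (R N).αData.isGalois (ιX y)).hom (ModelFrobenioid.div (R N).pair.den) = ModelFrobenioid.div (R N).pair.den)
  (α : ∀ {N N' : ℕ+}, (N : ℕ) ∣ N' → ((R N').AN ⟶ (R N).AN))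
  (β : ∀ {N N' : ℕ+}, (N : ℕ) ∣ N' → ((R N').BN ⟶ (R N).BN))
  (comm_sCap : ∀ {N N' : ℕ+} (hd : (N : ℕ) ∣ N'), (R N').pair.num ≫ β hd = α hd ≫ (R N).pair.num)
  (comm_sCup : ∀ {N N' : ℕ+} (hd : (N : ℕ) ∣ N'), (R N').pair.den ≫ β hd = α hd ≫ (R N).pair.den)
  (isIsometry_α : ∀ {N N' : ℕ+} (hd : (N : ℕ) ∣ N'),
    ((BiKummerSetting.mkOfConnectedTemperoidYddTower X tf hZ hP NH 𝒯 ιX).sec5Stub h).pre.IsIsometry (α hd))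
  (degFr_α : ∀ {N N' : ℕ+} (hd : (N : ℕ) ∣ N'),
    (((BiKummerSetting.mkOfConnectedTemperoidYddTower X tf hZ hP NH 𝒯 ιX).sec5Stub h).pre.degFr (α hd) : ℕ) * N = N')
  (isIsometry_β : ∀ {N N' : ℕ+} (hd : (N : ℕ) ∣ N'),
    ((BiKummerSetting.mkOfConnectedTemperoidYddTower X tf hZ hP NH 𝒯 ιX).sec5Stub h).pre.IsIsometry (β hd))
  (degFr_β : ∀ {N N' : ℕ+} (hd : (N : ℕ) ∣ N'),
    (((BiKummerSetting.mkOfConnectedTemperoidYddTower X tf hZ hP NH 𝒯 ιX).sec5Stub h).pre.degFr (β hd) : ℕ) * N = N')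
  (baseFrob_α : ∀ {N N' : ℕ+} (hd : (N : ℕ) ∣ N'),
    (BiKummerSetting.mkOfConnectedTemperoidYddTower X tf hZ hP NH 𝒯 ιX).IsOfBaseFrobeniusType (α hd))

  (h44 : BiKummerSetting.Thm44Hyp (BiKummerSetting.mkOfConnectedTemperoidYddTower X tf hZ hP NH 𝒯 ιX)
    (BiKummerSetting.mkOfConnectedTemperoidYddTower X tf hZ hP NH 𝒯 ιX))
  (ψ : ∀ A : (BiKummerSetting.mkOfConnectedTemperoidYddTower X tf hZ hP NH 𝒯 ιX).C,
    (BiKummerSetting.mkOfConnectedTemperoidYddTower X tf hZ hP NH 𝒯 ιX).biratUnits A ≃*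
      (BiKummerSetting.mkOfConnectedTemperoidYddTower X tf hZ hP NH 𝒯 ιX).biratUnits (h44.Ψ.functor.obj A))
  (hpull : ∀ {A A' : (BiKummerSetting.mkOfConnectedTemperoidYddTower X tf hZ hP NH 𝒯 ιX).C} (φ : A' ⟶ A)
    (f : (BiKummerSetting.mkOfConnectedTemperoidYddTower X tf hZ hP NH 𝒯 ιX).biratUnits A),
      ψ A' (pullFrac φ f) = pullFrac (h44.Ψ.functor.map φ) (ψ A f))
  (hii : BiKummerSetting.Thm44_ii h44 ψ) (h3 : h44.PreservesFrobeniusStructure) (h4b : h44.PreservesBaseFrobeniusTypeData)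
  (h8 : h44.PreservesAmple) (h15a : h44.PreservesFixedByHA ψ) (h15 : h44.PreservesSaturated ψ)
  -- (B1)/(B1′): the Def. 4.1 (iv) datum of each transition `α_{1,N}` and its pull-back compatibility
  (D : ∀ N : ℕ+, (BiKummerSetting.mkOfConnectedTemperoidYddTower X tf hZ hP NH 𝒯 ιX).BaseFrobeniusTypeData (α (one_dvd_level N)))

include hX₀ h comm_sCap comm_sCup isIsometry_α degFr_α isIsometry_β degFr_β hpull hii h3 h4b h8 h15a h15 in
/-- **[EtTh] Theorem 5.7 at the genuine connected tower — FINAL KNIT with the model-level binders discharged** (see the module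
docstring for the seven discharges and the residual list).  [cite: MochizukiEtTh2009, Thm 5.7 p.329–330 (PDF pp.103–104); Rmk 4.3.2 p.318–319 (PDF pp.92–93); Lem 5.8 p.331 (PDF p.105)] -/
theorem thetaRootPreservedAll_ofConnectedTemperoidYddFamily_final_reduced
    (T : ThetaFrobenioidTower.{w} (BiKummerSetting.mkOfConnectedTemperoidYddTower X tf hZ hP NH 𝒯 ιX).C
      (ConnectedPart (BTemp X.Pi)))
    (hT : T = ofConnectedTemperoidFamily h Q odd_l R ιX K' (fun N => (Units.map (tf.ratFnFunctor.map (t N).op).hom).comp c₀)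
      hinj hinvc hinvp α β comm_sCap comm_sCup isIsometry_α degFr_α isIsometry_β degFr_β baseFrob_α)
    (hnd : IsNonDilatingOn tf.divisorMonoid)
    (hgc₁ : ∀ u : (T.atLevel 1).units (T.BN 1),
      (∀ y ∈ (T.atLevel 1).imPiY, T.sgpCap 1 y * (u : Aut (T.BN 1)) * (T.sgpCap 1 y)⁻¹ = u) →
        (T.atLevel 1).unitsToBirat (T.BN 1) u ∈ (T.constEmb 1).range)
    (hfac₁ : ∀ y ∈ (T.atLevel 1).imPiY, ∃ x ∈ (T.atLevel 1).HB, ∀ u ∈ (T.atLevel 1).units (T.BN 1),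
      T.sgpCap 1 y * u * (T.sgpCap 1 y)⁻¹ = T.sgpCap 1 x * u * (T.sgpCap 1 x)⁻¹)
    -- the rendering law of `pullFrac` (the model's `((·)^birat)^*`), the transitions over the base pair, and the Prop. 2.4-class
    -- clause at the chosen first root ("`S₂^bs` characteristic", p.329): these DISCHARGE `hpull₂`, `hD`, `hf`, `hΨFT`, `hbs` of `…_final`
    (hF : ∀ {B B' : (BiKummerSetting.mkOfConnectedTemperoidYddTower X tf hZ hP NH 𝒯 ιX).C} (φ : B' ⟶ B)
      (y : (BiKummerSetting.mkOfConnectedTemperoidYddTower X tf hZ hP NH 𝒯 ιX).biratUnits B), pullFrac φ y = tf.pullFracModel φ y)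
    (hαover : ∀ N : ℕ+, α (one_dvd_level N) ≫ (R 1).α = (R N).α)
    (hcharN : IsTopCharacteristic X.Pi (galoisSurjOf X.isTempered (R 1).AN.base.obj (R 1).αData.isGalois).ker)
    (hdivA : ∀ αA : h44.Ψ.functor.obj (T.AN 1) ≅ T.AN 1, ∃ ε : Aut (T.AN 1),
      T.pre.div (αA.inv ≫ h44.Ψ.functor.map (T.sCap 1)) = T.pre.div (ε.hom ≫ T.sCap 1) ∧
      T.pre.div (αA.inv ≫ h44.Ψ.functor.map (T.sCup 1)) = T.pre.div (ε.hom ≫ T.sCup 1))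
    (hP24 : ∀ γ : 𝒯.PiX ≃ₜ* 𝒯.PiX, 𝒯.PiYdd.map γ.toMulEquiv.toMonoidHom = 𝒯.PiYdd)
    -- per anchor and level: clause (e) pointwise at the anchor, and the base isomorphism of `Ψ` at `A_N` over `α_{1,N}`
    (hArises : ∀ (α₁ : h44.Ψ.functor.obj (R 1).AN ≅ (R 1).AN) (N : ℕ+),
      (BiKummerSetting.mkOfConnectedTemperoidYddTower X tf hZ hP NH 𝒯 ιX).ArisesFromBaseFrobeniusPair
        ((D N).G.map (h44.Ψ.functor.mapAut (R N).AN)) (h44.Ψ.functor.map (D N).α₂) (h44.Ψ.functor.map (D N).α₁ ≫ α₁.hom))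
    (hebs : ∀ (α₁ : h44.Ψ.functor.obj (R 1).AN ≅ (R 1).AN) (N : ℕ+),
      ∃ ebs : (BiKummerSetting.mkOfConnectedTemperoidYddTower X tf hZ hP NH 𝒯 ιX).base.obj (R N).AN ≅
          (BiKummerSetting.mkOfConnectedTemperoidYddTower X tf hZ hP NH 𝒯 ιX).base.obj (h44.Ψ.functor.obj (R N).AN),
        (BiKummerSetting.mkOfConnectedTemperoidYddTower X tf hZ hP NH 𝒯 ιX).base.map (α (one_dvd_level N)) =
          ebs.hom ≫ (BiKummerSetting.mkOfConnectedTemperoidYddTower X tf hZ hP NH 𝒯 ιX).base.map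
            (h44.Ψ.functor.map (α (one_dvd_level N)) ≫ α₁.hom))
    -- per unit `u₁` and level: `hroot₁N` — an `N`-th root of the level-1 discrepancy unit on `B_N` over `β_{1,N}` (Lem. 5.8 /
    -- Def. 4.1 (iii)), with the `H_{A_N}`-fixedness of the pulled-back twisted function (abc-iut-f-123's reduction p443193)
    (hroot₁N : ∀ (u₁ : Aut (R 1).BN) (hu₁ : u₁ ∈ (BiKummerSetting.mkOfConnectedTemperoidYddTower X tf hZ hP NH 𝒯 ιX).units (R 1).BN)
      (N : ℕ+), ∃ (ut : Aut (R N).BN) (_ : ut ∈ (BiKummerSetting.mkOfConnectedTemperoidYddTower X tf hZ hP NH 𝒯 ιX).units (R N).BN),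
        ut.hom ≫ β (one_dvd_level N) = β (one_dvd_level N) ≫ u₁.hom ∧
        (BiKummerSetting.mkOfConnectedTemperoidYddTower X tf hZ hP NH 𝒯 ιX).IsFixedByHA (R N).AN (R N).isSaturated.isAmple.isGalois
          (pullFrac (D N).α₁
            ((BiKummerSetting.mkOfConnectedTemperoidYddTower X tf hZ hP NH 𝒯 ιX).fracOf (R 1).pair.num ((R 1).pair.den ≫ u₁.hom)
              (R 1).pair.isPreStep_num
              ((BiKummerSetting.mkOfConnectedTemperoidYddTower X tf hZ hP NH 𝒯 ιX).isPreStep_comp_aut (R 1).pair.isPreStep_den u₁)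
              ((BiKummerSetting.mkOfConnectedTemperoidYddTower X tf hZ hP NH 𝒯 ιX).baseEquivalent_comp_unit (R 1).pair.base_eq hu₁))))
    -- Prop. 4.2 (iv) at the `u₁`-twisted level-1 pair
    (hivP' : ∀ (u₁ : Aut (R 1).BN) (hu₁ : u₁ ∈ (BiKummerSetting.mkOfConnectedTemperoidYddTower X tf hZ hP NH 𝒯 ιX).units (R 1).BN)
      (N : ℕ+)
      (R' R'' : (BiKummerSetting.mkOfConnectedTemperoidYddTower X tf hZ hP NH 𝒯 ιX).NthRoot
        ((BiKummerSetting.mkOfConnectedTemperoidYddTower X tf hZ hP NH 𝒯 ιX).fracOf (R 1).pair.num ((R 1).pair.den ≫ u₁.hom)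
          (R 1).pair.isPreStep_num
          ((BiKummerSetting.mkOfConnectedTemperoidYddTower X tf hZ hP NH 𝒯 ιX).isPreStep_comp_aut (R 1).pair.isPreStep_den u₁)
          ((BiKummerSetting.mkOfConnectedTemperoidYddTower X tf hZ hP NH 𝒯 ιX).baseEquivalent_comp_unit (R 1).pair.base_eq hu₁))
        ((R 1).pair.twistUnit u₁ hu₁ rfl
          (BiKummerSetting.disjointSupports_twistUnit h.isDivisorial (R 1).pair u₁)) N pullFrac)
      (ebs : (BiKummerSetting.mkOfConnectedTemperoidYddTower X tf hZ hP NH 𝒯 ιX).base.obj R'.AN ≅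
        (BiKummerSetting.mkOfConnectedTemperoidYddTower X tf hZ hP NH 𝒯 ιX).base.obj R''.AN),
      (BiKummerSetting.mkOfConnectedTemperoidYddTower X tf hZ hP NH 𝒯 ιX).base.map R'.α =
        ebs.hom ≫ (BiKummerSetting.mkOfConnectedTemperoidYddTower X tf hZ hP NH 𝒯 ιX).base.map R''.α →
        ∃ (v : (BiKummerSetting.mkOfConnectedTemperoidYddTower X tf hZ hP NH 𝒯 ιX).mu R'.BN N) (ζA : R'.AN ≅ R''.AN)
          (ζB : R'.BN ≅ R''.BN),
          ζA.hom ≫ R''.pair.num = R'.pair.num ≫ ζB.hom ∧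
          ζA.hom ≫ R''.pair.den = (R'.pair.den ≫ (v : Aut R'.BN).hom) ≫ ζB.hom ∧
          ζA.hom ≫ R''.α = R'.α ∧ ζB.hom ≫ R''.β = R'.β ∧
          (BiKummerSetting.mkOfConnectedTemperoidYddTower X tf hZ hP NH 𝒯 ιX).base.mapIso ζA = ebs)
    -- (C): the level-1 discrepancy constant of every normalised transport is a `2l`-th root of unity
    (hc : ∀ (α₁ : h44.Ψ.functor.obj (T.AN 1) ≅ T.AN 1) (β₁ : h44.Ψ.functor.obj (T.BN 1) ≅ T.BN 1) (u₁ : Aut (T.BN 1))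
      (hu₁ : u₁ ∈ (T.atLevel 1).units (T.BN 1)),
      α₁.inv ≫ h44.Ψ.functor.map (T.sCap 1) ≫ β₁.hom = T.sCap 1 →
      α₁.inv ≫ h44.Ψ.functor.map (T.sCup 1) ≫ β₁.hom = T.sCup 1 ≫ u₁.hom →
        ∀ c : T.Kˣ, (T.atLevel 1).unitsToBirat (T.BN 1) ⟨u₁, hu₁⟩ = T.constEmb 1 c → c ^ (2 * T.l) = 1) :
    T.ThetaRootPreservedAll h44.Ψ := by
  -- `deg_Fr(α_{1,N}) = N = deg_Fr(β_{1,N})` from the tower's degree laws at `(1, N)`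
  have hdeg : ∀ {d N : ℕ+}, (d : ℕ) * ((1 : ℕ+) : ℕ) = N → d = N := fun hd => by
    rw [PNat.one_coe, mul_one] at hd
    exact PNat.coe_inj.mp hd
  have hD : ∀ N : ℕ+, pullFrac (D N).α₁ (R 1).root = pullFrac (R N).αData.α₁ Rl.root := fun N =>
    BiKummerSetting.NthRoot.rebase_hD_of_comp X tf hZ hP _ _ _ NH _ _ _ hF (R N) (R 1) (α (one_dvd_level N)) (D N) (hαover N)
  subst hT
  refine thetaRootPreservedAll_ofConnectedTemperoidYddFamily_final 𝒯 ιX h Q odd_l R K' hX₀ t c₀ hinj hinvc hinvp α β comm_sCap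
    comm_sCup isIsometry_α degFr_α isIsometry_β degFr_β baseFrob_α h44 ψ hpull hii h3 h4b h8 h15a h15
    (fun φ χ g => BiKummerSetting.pullFrac_comp_of_rendering X tf hZ hP _ _ _ NH _ _ _ hF φ χ g) D hD _ rfl hnd
    tf.exists_not_isGroupLikeObj_ofModel hgc₁ hfac₁ ?_ ?_ hdivA hP24 ?_ hArises hebs ?_ hivP' hc
  · -- `hΨFT`: `Ψ` preserves Frobenius-trivial objects (T44-L05)
    exact ThetaFrobenioid.preservesFrobeniusTrivial_ofConnectedTemperoidData_of_thm44 (T := 𝒯.level ⟨1, 𝒯.one_mem⟩) h Q odd_l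
      (R 1) ιX K' ((Units.map (tf.ratFnFunctor.map (t 1).op).hom).comp c₀) (hinj 1) (hinvc 1) (hinvp 1) h44 h3
  · -- `hbs`: `Ψ(A_1)^bs ≅ A_1^bs` from the characteristic kernel (Prop. 2.4 class)
    exact BiKummerSetting.nonempty_baseIso_map_of_isTopCharacteristic h hnd h44.Ψ (R 1).AN (R 1).αData.isGalois hcharN
  · -- `hf` for every normalised anchor: Thm. 4.4 (ii) at the model
    intro α₁ β₁ u₁ hu₁ hnum hden
    exact BiKummerSetting.FractionPair.hf_of_normalisedAnchor X tf hZ hP _ _ _ NH _ _ _ hF h44 ψ hii (R 1).pair u₁ hu₁ rfl α₁ β₁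
      hnum hden
  · -- `hroot`: `hroot₁N` + the `N`-th-power law (model) + saturation from fixedness, at the rebased root
    intro u₁ hu₁ N
    obtain ⟨ut, hut, hover, hfix⟩ := hroot₁N u₁ hu₁ N
    -- the level-`N` root rebased over the level-1 pair (abc-iut-f-121's `NthRoot.rebase`, p443132)
    let Rt := (R N).rebase (R 1) (α (one_dvd_level N)) (β (one_dvd_level N)) (comm_sCap (one_dvd_level N))
      (comm_sCup (one_dvd_level N)) (isIsometry_α (one_dvd_level N)) (isIsometry_β (one_dvd_level N))
      (hdeg (degFr_α (one_dvd_level N))) (hdeg (degFr_β (one_dvd_level N))) (D N) (hD N)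
    have hpow := BiKummerSetting.pow_twistRoot_eq_pullFrac_of_rendering X tf hZ hP _ _ _ NH _ _ _ hF Rt u₁ hu₁ ut hut hover
    exact ⟨ut, hut, hover, hpow, BiKummerSetting.isSaturated_twist_of_fixed Rt hpow hfix⟩

end Genuine

end ThetaFrobenioidTower

end Literature.AnabelianGeometry.EtaleTheta

end
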